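import Summits.ABC.IUTFork.Joshi.ArithmeticoidMultiplicative
import Summits.ABC.IUTFork.Joshi.ArithmeticoidsNumberFieldModel
import Mathlib.NumberTheory.NumberField.Units.DirichletTheorem
import Mathlib.NumberTheory.Cyclotomic.Basic
import Mathlib.NumberTheory.Cyclotomic.PrimitiveRoots
import HarnessLib

/-!
# [J-2½] Thm. 5.6.1 / Cor. 5.6.2 (`ATS2half.Thm561` / `ATS2half.Cor562`) DECIDED at the arithmetic model of
# `ATS2h.DeformationDatum` — both signs for Cor. 5.6.2 (block E, rung LADDER-ABC:A2.E, seat E-t48 gen 5)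

PROOF-SIDE NV companion (E-plan-2 RE-SEAT POLICY 09:48:21Z (2)) of seat E-t38's object file
`Joshi/ArithmeticoidMultiplicative.lean` (p432965), which types K. Joshi, *Construction of Arithmetic Teichmüller Spaces II½*,
arXiv:2305.10398v12 (UNREFEREED; bib `Joshi2023ATS2half`) §5.6 over seat E-t37's 28-field HYPOTHESIS structure
`ATS2h.DeformationDatum`: Joshi's multiplicative structure `K̃^×_{v,y} := lim_{x ↦ x^{p_v}} K^×_{y_v}` (`tildeUnitsAt`,
Def. 3.1.1 p.16 l.26–34 = Mathlib's monoid perfection), the per-factor tilt data `TiltDatum`, and the claim-`Prop`s `Thm561`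
(Thm. 5.6.1, p.35 l.37–48: «for each valuation v ∈ V_L one has an isomorphism of the respective multiplicative structures …
∏_v K̃_{1,v} ≃ ∏_v K̃_{2,v}») and `Cor562 T ι` (Cor. 5.6.2, p.35 l.51–68: «the topological isomorphism of Theorem 5.6.1 is
given explicitly by (x̃_v)_v ↦ (x̃_v^{p_v})_v, i.e. ϕ is the p_v-th power operation on the local multiplicative monoids
corresponding to y and ϕ(y)»). Before this file neither carried a kernel decision at any model in the tree. Locators «p.N
l.M» = line M of `pNNNN.txt` in `HOME/plan/repair/lit/renders/Joshi-arxiv-2305.10398-ATS2half/` (verified 2026-08-26).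

CARRIERS: this seat's ARITHMETIC model `ATS2h.NumberFieldModel.model L` (p434710) of `DeformationDatum` for EVERY number
field `L` (all places; `Y_v := ℤ` one Frobenius orbit, `ϕ_v = (· + 1)` at finite `v`; fibres `K_{y_v} := L_v = (L, |−|_v)`;
`p_v :=` residue characteristic, `1` at infinite `v`). IMPORTED BY NAME, nothing restated.

## 1. [folklore] What `K̃^×` IS at arithmetic (non-perfectoid) fibres
For a number field `F`, `p ≥ 2` and a tower `f (n+1)^p = f n` in `F^×`: every `f n` is a unit at every finite place
(valuation infinitely `p`-divisible), hence a unit of `𝓞 F`, hence a ROOT OF UNITY (`isOfFinOrder_of_tower`) by DIRICHLET'S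
UNIT THEOREM (Mathlib `NumberField.Units.basisModTorsion`: `(𝓞 F)ˣ ⧸ torsion` is `ℤ`-free, so a unit with `p^n`-th roots
for all `n` is torsion). So every coordinate of an element of `K̃^×_{v,y} = lim_{x ↦ x^{p_v}} (L_v)^×` at a finite place of
the model is a root of unity (`tildeUnitsAt_model_isOfFinOrder`): evaluated on a number field instead of an algebraically
closed perfectoid field, Joshi's construction sees ONLY `μ(L)`.

## 2. VERDICTS at the arithmetic model (kernel, standard axioms)
| claim-`Prop` (E-t38) | datum | verdict | decl |
|---|---|---|---|
| `Thm561 (model L)` | every number field `L` | ✓ HOLDS (`refl`: fibres `y`-independent) | `model_thm561` |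
| `Cor562 (idTiltDatum L) id` | `L = ℚ(ζ₄)`, `v ∣ 3` | ✗ FAILS (`ζ₄ ↦ ζ₄³ ≠ ζ₄`) | `not_cyclotomicFour_model_cor562` |
| `Cor562 (frobTiltDatum L) id` | every number field `L` | ✓ HOLDS | `model_cor562_frobTiltDatum` |

`idTiltDatum` identifies every `K̃^×_{v,y_m}` with `F̃_v := lim (L_v)^×` by the IDENTITY; `frobTiltDatum` by the identity
precomposed with `(x̃ ↦ x̃^{p_v})^{-m}` along `Y_v = ℤ` (the arithmetic cartoon of print's mechanism, proof of Cor. 5.6.2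
p.35 l.69–70 «clear from Theorem 5.6.1, Theorem 4.2.3 and Corollary 4.2.5»: the tilt identification at `ϕ(y)` is the one at
`y` twisted by Frobenius); `ι = id` as the fibres do not depend on `y`. `model_cor562_iff`: for the identity datum the
typed Cor. 5.6.2 says exactly «`x̃ ↦ x̃^{p_v}` is the identity on every `K̃^×_v`».

READING (located, NOT adjudicated; no S bearing — class (b2) «S-ABSENT» of E-t58's `TestArithmeticoidsPinned` census):
`Cor562` as typed is a property of the chosen tilt identifications `(T, ι)`, NOT of the deformation datum — at ONE
`DeformationDatum` (`model ℚ(ζ₄)`) it holds for `frobTiltDatum` and fails for `idTiltDatum`; `TiltDatum` records the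
identifications `K̃^×_{v,y_v} ≃ F̃_v` as bare data with no compatibility with `ϕ`, so Cor. 5.6.2 is not derivable from
`DeformationDatum` + `TiltDatum`. And at arithmetic fibres «ϕ = the p_v-th power map» permutes roots of unity: the content
of §5.6 lives in the perfectoid (p-divisible) setting, which no field of `DeformationDatum` records (cf. this seat's gen-4
pair on Prop. 5.15.1, p443805 / p445686: decided by the algebraic closedness of `K_{y_v}`, likewise unrecorded).
NOT HERE: no claim about Joshi's perfectoid `K̃`, Lem. 3.1.4 or Thm. 3.2.2 (E-t38's claims, untouched); no new claim-`Prop`,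
no instance, no axiom, no `sorry`; DEFS-FREEZE parents imported BY NAME. New `def`s (model data, review lane):
`tildeSubgroup`, `idTilt`, `idTiltDatum`, `shiftTilt`, `powTilt`, `frobTilt`, `frobTiltDatum`, `CyclotomicFour`. **No side is
taken** on [IUTchIII] Cor. 3.12, on Joshi's claims, or on any author; typed ≠ proved; a model exhibits satisfiability,
nothing more. `[claim: Joshi2023ATS2half, status: disputed]` tags only the claim-`Prop` verdicts; the rest is [folklore]
(Dirichlet / Mathlib). bears_on: LADDER-ABC:A2.E
-/

-- justification: Mathlib is BUILT with `maxSynthPendingDepth 3` (its lakefile `mathlibLeanOptions`); the instances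
-- `Module ℤ (Additive ((𝓞 L)ˣ ⧸ torsion L))` (Dirichlet's `basisModTorsion`) and `IsCyclotomicExtension {4} ℚ
-- (CyclotomicField 4 ℚ)` are found only at that depth (tree precedent: `Summits/FinalStateConjecture/…/Disproof.lean`).
set_option maxSynthPendingDepth 3

noncomputable section

open NumberField

namespace Summit.ABC.IUTFork.Joshi.ATS2half
universe u

section Folklore

/-! ## 1. [folklore] `p`-power towers in the unit group of a number field consist of roots of unity -/

/-- An integer divisible by every power of some `p ≥ 2` is zero. [folklore] -/
theorem int_eq_zero_of_forall_pow_dvd {p : ℕ} (hp : 2 ≤ p) {a : ℤ} (h : ∀ n : ℕ, (p : ℤ) ^ n ∣ a) : a = 0 := by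
  by_contra ha
  have h2 : p ^ a.natAbs ∣ a.natAbs := by
    have h1 := Int.natAbs_dvd_natAbs.2 (h a.natAbs)
    rwa [Int.natAbs_pow, Int.natAbs_natCast] at h1
  exact Nat.lt_irrefl _ ((Nat.lt_pow_self (by omega)).trans_le (Nat.le_of_dvd (Int.natAbs_pos.2 ha) h2))

/-- In a `p`-power tower `f (n+1) ^ p = f n` of a monoid, `f (n + k) ^ (p ^ k) = f n`. [folklore] -/
theorem pow_pow_eq_of_tower {M : Type*} [Monoid M] {p : ℕ} {f : ℕ → M} (hf : ∀ n, f (n + 1) ^ p = f n)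
    (n k : ℕ) : f (n + k) ^ (p ^ k) = f n := by
  induction k with
  | zero => simp
  | succ k ih => rw [← add_assoc, pow_succ', pow_mul, hf, ih]

variable {F : Type*} [Field F] [NumberField F]

/-- In a `p`-power tower of non-zero elements of a number field (`p ≥ 2`), every member is a unit at every finite
place: its valuation is infinitely `p`-divisible in `ℤ`. [folklore] -/
theorem valuation_eq_one_of_tower {p : ℕ} (hp : 2 ≤ p) {f : ℕ → Fˣ} (hf : ∀ n, f (n + 1) ^ p = f n)
    (w : IsDedekindDomain.HeightOneSpectrum (𝓞 F)) (n : ℕ) : w.valuation F (f n : F) = 1 := by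
  have hv0 : ∀ m, w.valuation F (f m : F) ≠ 0 := fun m => (Valuation.ne_zero_iff _).2 (f m).ne_zero
  have hlog : WithZero.log (w.valuation F (f n : F)) = 0 := by
    refine int_eq_zero_of_forall_pow_dvd hp fun k => ⟨WithZero.log (w.valuation F (f (n + k) : F)), ?_⟩
    rw [← pow_pow_eq_of_tower hf n k, Units.val_pow_eq_pow_val, map_pow, WithZero.log_pow, nsmul_eq_mul,
      Nat.cast_pow]
  rw [← WithZero.exp_log (hv0 n), hlog, WithZero.exp_zero]

/-- … hence (the image of) an algebraic integer. [folklore] -/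
theorem mem_range_of_tower {p : ℕ} (hp : 2 ≤ p) {f : ℕ → Fˣ} (hf : ∀ n, f (n + 1) ^ p = f n) (n : ℕ) :
    (f n : F) ∈ (algebraMap (𝓞 F) F).range :=
  IsDedekindDomain.HeightOneSpectrum.mem_integers_of_valuation_le_one F (f n : F)
    fun w => (valuation_eq_one_of_tower hp hf w n).le

/-- … and the tower lifts to a `p`-power tower of UNITS of `𝓞 F`. [folklore] -/
theorem exists_units_tower {p : ℕ} (hp : 2 ≤ p) {f : ℕ → Fˣ} (hf : ∀ n, f (n + 1) ^ p = f n) :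
    ∃ g : ℕ → (𝓞 F)ˣ, (∀ n, Units.map (algebraMap (𝓞 F) F).toMonoidHom (g n) = f n) ∧
      ∀ n, g (n + 1) ^ p = g n := by
  have hf' : ∀ n, (f (n + 1))⁻¹ ^ p = (f n)⁻¹ := fun n => by rw [inv_pow, hf]
  choose a ha using fun n => mem_range_of_tower hp hf n
  choose b hb using fun n => mem_range_of_tower hp (f := fun n => (f n)⁻¹) hf' n
  have hinj : Function.Injective (algebraMap (𝓞 F) F) := IsFractionRing.injective (𝓞 F) F
  have hab : ∀ n, a n * b n = 1 := fun n => hinj (by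
    rw [map_mul, ha, hb, map_one, Units.val_inv_eq_inv_val, mul_inv_cancel₀ (f n).ne_zero])
  refine ⟨fun n => ⟨a n, b n, hab n, by rw [mul_comm, hab]⟩, fun n => Units.ext (ha n), fun n => Units.ext (hinj ?_)⟩
  change algebraMap (𝓞 F) F (a (n + 1) ^ p) = algebraMap (𝓞 F) F (a n)
  rw [map_pow, ha, ha, ← hf n, Units.val_pow_eq_pow_val]

/-- **Dirichlet**: a unit of `𝓞 F` admitting a `p^n`-th root for every `n` (`p ≥ 2`) is a root of unity — its coordinates on
Mathlib's `basisModTorsion` of the free `ℤ`-module `(𝓞 F)ˣ ⧸ torsion` are infinitely `p`-divisible. [folklore] -/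
theorem mem_torsion_of_forall_pow_eq {p : ℕ} (hp : 2 ≤ p) {x : (𝓞 F)ˣ}
    (h : ∀ n : ℕ, ∃ y : (𝓞 F)ˣ, y ^ (p ^ n) = x) : x ∈ Units.torsion F := by
  classical
  rw [← QuotientGroup.eq_one_iff, ← ofMul_eq_zero]
  refine Module.Basis.ext_elem (Units.basisModTorsion F) fun i => ?_
  rw [map_zero, Finsupp.zero_apply]
  refine int_eq_zero_of_forall_pow_dvd hp fun n => ?_
  obtain ⟨y, hy⟩ := h n
  refine ⟨(Units.basisModTorsion F).repr (Additive.ofMul (QuotientGroup.mk y)) i, ?_⟩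
  rw [← hy, QuotientGroup.mk_pow, ofMul_pow, map_nsmul, Finsupp.smul_apply, nsmul_eq_mul, Nat.cast_pow]

/-- **`lim_{x ↦ x^p} F^×` consists of roots of unity** (`F` a number field, `p ≥ 2`): every member of a `p`-power tower in
`F^×` has finite order. [folklore] -/
theorem isOfFinOrder_of_tower {p : ℕ} (hp : 2 ≤ p) {f : ℕ → Fˣ} (hf : ∀ n, f (n + 1) ^ p = f n) (n : ℕ) :
    IsOfFinOrder (f n) := by
  obtain ⟨g, hg, hg'⟩ := exists_units_tower hp hf
  have ht : g n ∈ Units.torsion F :=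
    mem_torsion_of_forall_pow_eq hp fun k => ⟨g (n + k), pow_pow_eq_of_tower hg' n k⟩
  rw [← hg n]
  exact (Units.map (algebraMap (𝓞 F) F).toMonoidHom).isOfFinOrder ((CommGroup.mem_torsion _).1 ht)

end Folklore

/-! ## 2. The verdicts at the arithmetic model `ATS2h.NumberFieldModel.model L` -/

section Model

open Summit.ABC.IUTFork.Joshi.ATS2h Summit.ABC.IUTFork.Joshi.ATS2h.NumberFieldModel

variable (L : Type) [Field L] [NumberField L]

/-- **At a finite place of the arithmetic model every coordinate of an element of Joshi's `K̃^×_{v,y} = lim_{x ↦ x^{p_v}}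
K^×_{y_v}` is a ROOT OF UNITY of `L`** (`K_{y_v} = L_v = (L, |−|_v)`, `p_v ≥ 2`). [folklore] -/
theorem tildeUnitsAt_model_isOfFinOrder (w : FinitePlace L) (y : ℤ)
    (f : tildeUnitsAt (model L) (Sum.inr w) y) (n : ℕ) : IsOfFinOrder (f.1 n) := by
  set e : Loc L (Sum.inr w) ≃+* L := WithAbs.equiv (absval L (Sum.inr w))
  have hp : 2 ≤ resChar L (Sum.inr w) := (resChar_prime L w).two_le
  have hf : ∀ m, f.1 (m + 1) ^ resChar L (Sum.inr w) = f.1 m := f.2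
  have h := isOfFinOrder_of_tower (F := L) hp (f := fun m => Units.map e.toRingHom.toMonoidHom (f.1 m))
    (fun m => by simp only [← map_pow, hf]) n
  rw [show f.1 n = Units.map e.symm.toRingHom.toMonoidHom (Units.map e.toRingHom.toMonoidHom (f.1 n)) by ext; simp]
  exact (Units.map e.symm.toRingHom.toMonoidHom).isOfFinOrder h

/-- **Thm. 5.6.1 (`Thm561`) HOLDS at the arithmetic model**, for every number field: the fibres `K_{y_v} = L_v` do not
depend on `y`, so `K̃^×_{v,y₁}` and `K̃^×_{v,y₂}` are the SAME topological monoid (`refl`). [claim: Joshi2023ATS2half,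
status: disputed] -/
theorem model_thm561 : Thm561 (model L) := fun _ _ => ⟨fun _ => ⟨.refl _⟩, ⟨.refl _⟩⟩

/-- `lim_{x ↦ x^p} G` for a commutative GROUP `G` is a subgroup of `ℕ → G` (inverses coordinatewise). [folklore] -/
def tildeSubgroup (G : Type u) [CommGroup G] (p : ℕ) : Subgroup (ℕ → G) :=
  { tildeMonoid G p with
    inv_mem' := fun {f} hf n => by change (f (n + 1))⁻¹ ^ p = (f n)⁻¹; rw [inv_pow, hf n] }

variable {L} in
/-- The IDENTITY tilt at a place of the arithmetic model: `K̃^×_{v,y} = lim (L_v)^×` onto itself (as a group). [folklore] -/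
def idTilt (v : Place L) :
    tildeMonoid (Loc L v)ˣ (resChar L v) ≃ₜ* tildeSubgroup (Loc L v)ˣ (resChar L v) where
  toFun f := ⟨f.1, f.2⟩
  invFun g := ⟨g.1, g.2⟩
  left_inv _ := rfl
  right_inv _ := rfl
  map_mul' _ _ := rfl
  continuous_toFun := Continuous.subtype_mk continuous_subtype_val _
  continuous_invFun := Continuous.subtype_mk continuous_subtype_val _

/-- **The identity tilt datum of the arithmetic model**: E-t38's `TiltDatum` (the identifications `K̃^×_{v,y_v} ≃ F̃_v` the
printed proof of Thm. 5.6.1 names) with `F̃_v := lim (L_v)^×` and every identification the identity. [folklore] -/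
def idTiltDatum : TiltDatum (model L) (fun v => tildeSubgroup (Loc L v)ˣ (resChar L v)) where
  tilt v _ := idTilt v

/-- Along the identity tilt datum the Thm. 5.6.1 isomorphism is the identity. [folklore] -/
theorem idTiltDatum_thm561Iso (y₁ y₂ : (model L).Arith) (x : ∀ v, tildeUnitsAt (model L) v (y₁ v)) (v : Place L) :
    (idTiltDatum L).thm561Iso y₁ y₂ x v = x v := rfl

/-- `tildeMap` of the identity is the identity. [folklore] -/
theorem tildeMap_refl {M : Type u} [CommMonoid M] {p : ℕ} (f : tildeMonoid M p) :
    tildeMap (MulEquiv.refl M) f = f := rfl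

/-- **Cor. 5.6.2 (`Cor562`) at the arithmetic model, identity tilt datum, `ι = id`, UNFOLDED**: it says exactly that
`x̃ ↦ x̃^{p_v}` is the identity on every `K̃^×_v = lim_{x ↦ x^{p_v}} (L_v)^×`. [claim: Joshi2023ATS2half, status: disputed] -/
theorem model_cor562_iff :
    Cor562 (idTiltDatum L) (fun _ _ => MulEquiv.refl _) ↔
      ∀ (v : Place L) (z : tildeMonoid (Loc L v)ˣ (resChar L v)) (n : ℕ), z.1 n ^ resChar L v = z.1 n := by
  classical
  constructor
  · intro h v z n
    have h1 := congrArg (fun t : tildeMonoid (Loc L v)ˣ (resChar L v) => t.1 n)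
      (h (fun _ => 0) (Function.update (fun w => (1 : tildeUnitsAt (model L) w 0)) v z) v)
    dsimp only at h1
    rw [tildeMap_refl, idTiltDatum_thm561Iso, powFamily_apply_coe, Function.update_self] at h1
    exact h1.symm
  · intro h y x v
    rw [tildeMap_refl, idTiltDatum_thm561Iso]
    exact Subtype.ext (funext fun n => by rw [powFamily_apply_coe]; exact (h v (x v) n).symm)

/-! ### The Frobenius-twisted tilt datum: Cor. 5.6.2 HOLDS for every number field -/

variable {L}

/-- The tilt identification at the point `k ≥ 0` of the Frobenius orbit `Y_v = ℤ`: `(x_n) ↦ (x_{n+k})` (= `(x ↦ x^{p_v})^{-k}`),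
inverse `(x_n) ↦ (x_n^{p_v^k})`. [folklore] -/
def shiftTilt (v : Place L) (k : ℕ) :
    tildeMonoid (Loc L v)ˣ (resChar L v) ≃ₜ* tildeSubgroup (Loc L v)ˣ (resChar L v) where
  toFun f := ⟨fun n => f.1 (n + k), fun n => by
    change f.1 (n + 1 + k) ^ resChar L v = f.1 (n + k); rw [Nat.add_right_comm]; exact f.2 (n + k)⟩
  invFun g := ⟨fun n => g.1 n ^ resChar L v ^ k, fun n => by
    change (g.1 (n + 1) ^ resChar L v ^ k) ^ resChar L v = g.1 n ^ resChar L v ^ k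
    rw [← pow_mul, mul_comm, pow_mul, g.2 n]⟩
  left_inv f := Subtype.ext (funext fun n => pow_pow_eq_of_tower f.2 n k)
  right_inv g := Subtype.ext (funext fun n => pow_pow_eq_of_tower g.2 n k)
  map_mul' _ _ := rfl
  continuous_toFun := by
    apply Continuous.subtype_mk
    exact continuous_pi fun n => (continuous_apply (n + k)).comp continuous_subtype_val
  continuous_invFun := by
    apply Continuous.subtype_mk
    exact continuous_pi fun n => ((continuous_apply n).comp continuous_subtype_val).pow _

/-- The tilt identification at the point `-k ≤ 0` of the Frobenius orbit: `(x_n) ↦ (x_n^{p_v^k})` (= `(x ↦ x^{p_v})^{k}`),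
inverse `(x_n) ↦ (x_{n+k})`. [folklore] -/
def powTilt (v : Place L) (k : ℕ) :
    tildeMonoid (Loc L v)ˣ (resChar L v) ≃ₜ* tildeSubgroup (Loc L v)ˣ (resChar L v) where
  toFun f := ⟨fun n => f.1 n ^ resChar L v ^ k, fun n => by
    change (f.1 (n + 1) ^ resChar L v ^ k) ^ resChar L v = f.1 n ^ resChar L v ^ k
    rw [← pow_mul, mul_comm, pow_mul, f.2 n]⟩
  invFun g := ⟨fun n => g.1 (n + k), fun n => by
    change g.1 (n + 1 + k) ^ resChar L v = g.1 (n + k); rw [Nat.add_right_comm]; exact g.2 (n + k)⟩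
  left_inv f := Subtype.ext (funext fun n => pow_pow_eq_of_tower f.2 n k)
  right_inv g := Subtype.ext (funext fun n => pow_pow_eq_of_tower g.2 n k)
  map_mul' f g := Subtype.ext (funext fun n => mul_pow (f.1 n) (g.1 n) _)
  continuous_toFun := by
    apply Continuous.subtype_mk
    exact continuous_pi fun n => ((continuous_apply n).comp continuous_subtype_val).pow _
  continuous_invFun := by
    apply Continuous.subtype_mk
    exact continuous_pi fun n => (continuous_apply (n + k)).comp continuous_subtype_val

/-- **The Frobenius-twisted tilt identifications** `K̃^×_{v,y_m} ≃ F̃_v` along the orbit `Y_v = ℤ`: at `m` the identity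
PRECOMPOSED WITH `(x̃ ↦ x̃^{p_v})^{-m}` — the arithmetic cartoon of print's mechanism («the tilting structure at `ϕ(y)` is the
one at `y` twisted by Frobenius», Thm. 4.2.3 / Cor. 4.2.5 as cited in the proof of Cor. 5.6.2, p.35 l.66). [folklore] -/
def frobTilt (v : Place L) : ℤ → (tildeMonoid (Loc L v)ˣ (resChar L v) ≃ₜ* tildeSubgroup (Loc L v)ˣ (resChar L v))
  | Int.ofNat k => shiftTilt v k
  | Int.negSucc k => powTilt v (k + 1)

/-- `frobTilt` at `k ≥ 0`. [folklore] -/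
@[simp] theorem frobTilt_natCast (v : Place L) (k : ℕ) : frobTilt v (k : ℤ) = shiftTilt v k := rfl

/-- `frobTilt` at `-(k+1)`. [folklore] -/
@[simp] theorem frobTilt_negSucc (v : Place L) (k : ℕ) : frobTilt v (Int.negSucc k) = powTilt v (k + 1) := rfl

variable (L)

/-- `-[k+2] + 1 = -[k+1]`. [folklore] -/
theorem negSucc_succ_add_one (k : ℕ) : Int.negSucc (k + 1) + 1 = Int.negSucc k := by
  simp only [Int.negSucc_eq]; push_cast; ring

/-- **The Frobenius-twisted tilt datum of the arithmetic model.** [folklore] -/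
def frobTiltDatum : TiltDatum (model L) (fun v => tildeSubgroup (Loc L v)ˣ (resChar L v)) where
  tilt v m := frobTilt v m

/-- **Cor. 5.6.2 (`Cor562`) HOLDS at the arithmetic model of EVERY number field for the Frobenius-twisted tilt datum**
(`ι = id`): along `y ↦ ϕ(y) = y + 1` the composite `tilt_{m+1}⁻¹ ∘ tilt_m` IS `x̃ ↦ x̃^{p_v}` on every `K̃^×_v` (and the
identity at archimedean `v`, where `p_v = 1`, `ϕ_v = 1`). [claim: Joshi2023ATS2half, status: disputed] -/
theorem model_cor562_frobTiltDatum : Cor562 (frobTiltDatum L) (fun _ _ => MulEquiv.refl _) := by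
  intro y x v
  change (frobTiltDatum L).thm561Iso y ((model L).frobY y) x v = powFamily (model L) y x v
  refine Subtype.ext (funext fun n => ?_)
  rw [TiltDatum.thm561Iso_apply, powFamily_apply_coe]
  rcases v with u | w
  · -- archimedean place: `ϕ_v = 1`, `p_v = 1`
    change ((frobTilt (Sum.inl u) (y (Sum.inl u))).symm (frobTilt (Sum.inl u) (y (Sum.inl u)) (x (Sum.inl u)))).1 n =
      (x (Sum.inl u)).1 n ^ 1
    rw [ContinuousMulEquiv.symm_apply_apply, pow_one]
  · -- finite place: `ϕ_v(m) = m + 1`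
    set z : tildeMonoid (Loc L (Sum.inr w))ˣ (resChar L (Sum.inr w)) := x (Sum.inr w)
    clear_value z
    change ((frobTilt (Sum.inr w) (y (Sum.inr w) + 1)).symm (frobTilt (Sum.inr w) (y (Sum.inr w)) z)).1 n =
      z.1 n ^ resChar L (Sum.inr w)
    rcases y (Sum.inr w) with k | (_ | k)
    · -- `m = k ≥ 0`: `tilt_{k+1}⁻¹ (tilt_k z)_n = z_{n+k}^{p^{k+1}} = z_n^p`
      rw [show (Int.ofNat k : ℤ) + 1 = ((k + 1 : ℕ) : ℤ) by push_cast; rfl, show (Int.ofNat k : ℤ) = (k : ℤ) from rfl,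
        frobTilt_natCast, frobTilt_natCast]
      change z.1 (n + k) ^ resChar L (Sum.inr w) ^ (k + 1) = _
      rw [pow_succ, pow_mul, pow_pow_eq_of_tower z.2 n k]
    · -- `m = -1`: `tilt_0⁻¹ (tilt_{-1} z)_n = (z_n^p)^{p^0}`
      rw [show Int.negSucc 0 + 1 = ((0 : ℕ) : ℤ) by rfl, frobTilt_natCast, frobTilt_negSucc]
      change (z.1 n ^ resChar L (Sum.inr w) ^ 1) ^ resChar L (Sum.inr w) ^ 0 = _
      rw [pow_zero, pow_one, pow_one]
    · -- `m = -(k+2)`: `tilt_{-(k+1)}⁻¹ (tilt_{-(k+2)} z)_n = z_{n+k+1}^{p^{k+2}} = z_n^p`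
      rw [negSucc_succ_add_one, frobTilt_negSucc, frobTilt_negSucc]
      change z.1 (n + (k + 1)) ^ resChar L (Sum.inr w) ^ (k + 1 + 1) = _
      rw [pow_succ, pow_mul, pow_pow_eq_of_tower z.2 n (k + 1)]

/-! ### `L = ℚ(ζ₄)`: FAILS -/

/-- `ℚ(ζ₄)` (Mathlib's cyclotomic field). [folklore] -/
abbrev CyclotomicFour : Type := CyclotomicField 4 ℚ

/-- `ℚ(ζ₄)` has a finite place of residue characteristic `3` (any prime of `𝓞` above `3`). [folklore] -/
theorem cyclotomicFour_exists_resChar_eq_three : ∃ w : FinitePlace CyclotomicFour, resChar CyclotomicFour (Sum.inr w) = 3 := by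
  classical
  set O := 𝓞 CyclotomicFour
  have h3 : (3 : O) = algebraMap ℤ O 3 := by simp
  have habs : Ideal.absNorm (Ideal.span {(3 : O)}) = 3 ^ Module.finrank ℤ O := by
    rw [Ideal.absNorm_span_singleton, h3, Algebra.norm_algebraMap, Int.natAbs_pow]
    rfl
  have hrank : Module.finrank ℤ O ≠ 0 := Module.finrank_pos.ne'
  have htop : Ideal.span {(3 : O)} ≠ ⊤ := by
    intro h
    have h1 := Ideal.absNorm_eq_one_iff.2 h
    rw [habs] at h1
    rcases Nat.pow_eq_one.1 h1 with h2 | h2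
    · norm_num at h2
    · exact hrank h2
  obtain ⟨M, hM, hle⟩ := Ideal.exists_le_maximal _ htop
  have hbot : M ≠ ⊥ := by
    intro hb
    have h3m : (3 : O) ∈ M := hle (Ideal.mem_span_singleton_self _)
    rw [hb, Ideal.mem_bot, h3] at h3m
    have h4 : (3 : ℤ) = 0 := (algebraMap ℤ O).injective_int (by rw [h3m, map_zero])
    norm_num at h4
  let P : IsDedekindDomain.HeightOneSpectrum O := ⟨M, hM.isPrime, hbot⟩
  refine ⟨FinitePlace.mk P, ?_⟩
  have hdvd : Ideal.absNorm M ∣ 3 ^ Module.finrank ℤ O := by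
    rw [← habs]
    exact map_dvd Ideal.absNorm (Ideal.dvd_iff_le.2 hle)
  obtain ⟨j, -, hj⟩ := (Nat.dvd_prime_pow Nat.prime_three).1 hdvd
  have hj0 : j ≠ 0 := by
    rintro rfl
    rw [pow_zero, Ideal.absNorm_eq_one_iff] at hj
    exact hM.ne_top hj
  change (Ideal.absNorm (FinitePlace.mk P).maximalIdeal.asIdeal).minFac = 3
  rw [FinitePlace.maximalIdeal_mk, show P.asIdeal = M from rfl, hj, Nat.pow_minFac hj0]
  exact Nat.prime_three.minFac_eq

/-- **Cor. 5.6.2 FAILS at the arithmetic model of `ℚ(ζ₄)`** (identity tilt datum, `ι = id`): at a place `v` over `3`,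
`K̃^×_v = lim_{x ↦ x³} ℚ(ζ₄)^×` contains the tower `(ζ₄^{3^n})_n`, and `ζ₄³ = ζ₄⁻¹ ≠ ζ₄`. [claim: Joshi2023ATS2half,
status: disputed] -/
theorem not_cyclotomicFour_model_cor562 : ¬ Cor562 (idTiltDatum CyclotomicFour) (fun _ _ => MulEquiv.refl _) := by
  haveI : IsCyclotomicExtension {4} ℚ CyclotomicFour := CyclotomicField.isCyclotomicExtension 4 ℚ
  rw [model_cor562_iff]
  obtain ⟨w, hw⟩ := cyclotomicFour_exists_resChar_eq_three
  have hζ := IsCyclotomicExtension.zeta_spec 4 ℚ CyclotomicFour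
  obtain ⟨u, hu⟩ : ∃ u : (Loc CyclotomicFour (Sum.inr w))ˣ,
      (u : Loc CyclotomicFour (Sum.inr w)) = toLoc CyclotomicFour (Sum.inr w) (IsCyclotomicExtension.zeta 4 ℚ CyclotomicFour) :=
    ⟨Units.mk0 _ ((map_ne_zero _).2 (hζ.ne_zero (by norm_num))), rfl⟩
  have hu4 : u ^ 4 = 1 := Units.ext (by
    rw [Units.val_pow_eq_pow_val, hu, ← map_pow, hζ.pow_eq_one, map_one, Units.val_one])
  have hu2 : u ^ 2 ≠ 1 := fun h => by
    have h1 : (u : Loc CyclotomicFour (Sum.inr w)) ^ 2 = 1 := by rw [← Units.val_pow_eq_pow_val, h, Units.val_one]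
    rw [hu, ← map_pow] at h1
    exact hζ.pow_ne_one_of_pos_of_lt (by norm_num) (by norm_num)
      ((toLoc CyclotomicFour (Sum.inr w)).injective (h1.trans (map_one _).symm))
  -- the tower `n ↦ ζ₄ ^ 3 ^ n` lies in `K̃^×_v = lim_{x ↦ x³} (L_v)^×`
  have hmem : (fun n => u ^ 3 ^ n) ∈ tildeMonoid (Loc CyclotomicFour (Sum.inr w))ˣ (resChar CyclotomicFour (Sum.inr w)) := by
    intro n
    change (u ^ 3 ^ (n + 1)) ^ resChar CyclotomicFour (Sum.inr w) = u ^ 3 ^ n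
    rw [hw, ← pow_mul, show 3 ^ (n + 1) * 3 = 3 ^ n + 4 * (2 * 3 ^ n) by ring, pow_add, pow_mul, hu4,
      one_pow, mul_one]
  intro h
  have h1 := h (Sum.inr w) ⟨_, hmem⟩ 0
  change (u ^ 3 ^ 0) ^ resChar CyclotomicFour (Sum.inr w) = u ^ 3 ^ 0 at h1
  rw [hw, pow_zero, pow_one] at h1
  apply hu2 -- `u³ = u` forces `u² = 1`
  calc u ^ 2 = u ^ 3 * u⁻¹ := by group
    _ = 1 := by rw [h1, mul_inv_cancel]

end Model
end Summit.ABC.IUTFork.Joshi.ATS2half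
end
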